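import Literature.AnabelianGeometry.SemiGraphs.TemperedCompactVerticialOrCommutative
import HarnessLib

/-!
# Compact subgroups of `π₁^temp(𝒢)` lying in NO verticial subgroup are LEVELWISE EDGE-LIKE; with procyclic edge
# groups they are LEVELWISE CYCLIC (proof-only)

Mochizuki, *Semi-graphs of anabelioids*, Publ. RIMS **42** (2006), §3, Theorem 3.7 (iii)–(iv) pp. 40–41, Remark
2.2.1 p. 24 [cite: MochizukiSemiAnbd2006, Thm 3.7(iii) pp.40-41].

PROOF-ONLY file (abc-iut cell, layer L3, row «ANCHORED@STAR» sequel, seat abc-iut-w6-d064 gen 7; no definition, no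
named fact).  The structural content of the case analysis of this seat's `le_verticial_or_commutative_of_commEdges`
(`TemperedCompactVerticialOrCommutative.lean`), now with NO hypothesis on the edge groups: for every countable `𝒢`
satisfying the hypotheses of [SemiAnbd] Prop 3.6 (any `𝔾`), at the canonical chart,

* `exists_level_forall_proj_eq_gal_conj_brHom_of_forall_not_le_verticial` — **a compact `K ≤ π₁^temp(𝒢)` lying in
  NO verticial subgroup is, from some level `j₁` on, LEVELWISE EDGE-LIKE**: at every level `m ≥ j₁` there are a base
  vertex `w`, a compatible point sequence `P` over `w`, a branch `b` at `w` and ONE `f ∈ Π_w` such that the level-`m`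
  component of every `g ∈ K` is `σ_m^{f·b_*(k)·f⁻¹}` for some `k ∈ Π_e` (`e` the edge of `b`) — all of `ρ_m(K)` inside
  the image of ONE conjugate of ONE edge group.  (If the `K`-fixed subtree of `𝒢_{∞,j}` were a single vertex for
  cofinally many `j`, `K` would fix a compatible vertex system and lie in a verticial subgroup, (I2); so eventually
  two vertices, hence a branch, are fixed, and abc-iut-L3-t11's branch-stabiliser dictionary with one conjugator per
  branch applies.)
* `forall_level_exists_zpowers_of_forall_not_le_verticial_of_topCyclic` — **if the edge groups are topologically
  cyclic, every such `K` is LEVELWISE CYCLIC**: at EVERY level `j`, `ρ_j(K) ≤ ⟨γ_j⟩` for one `γ_j ∈ Gal(𝒢_{∞,j}/𝒢)`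
  (the continuous image of the procyclic `Π_e` in the discrete `Gal` is the cyclic group generated by the image of a
  topological generator; lower levels by `mapLE`).  So every violator of the ∃-sentence of Thm 3.7 (iii) and every
  exotic maximal compact subgroup is an inverse limit of finite CYCLIC groups — pro-cyclic, like the escaping
  `⟨c⟩‾ ≅ ℤ_p` at `𝒢⋆(p)` (abc-iut-L3-t8, p489415) and the exotic maximal compact `C ≅ ℤ_p` at `𝒢_θ` (abc-iut-w6-d063):
  instances `metabelianLeafStar_forall_level_exists_zpowers_of_forall_not_le_verticial`,
  `thetaRayFreeProP_forall_level_exists_zpowers_of_forall_not_le_verticial`.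

Honest framing: OUR typed `π₁^temp`; canonical chart (other charts are isomorphic to it compatibly,
`TemperedPiChart.exists_compatIso`); nothing bears on [IUTchIII] Cor. 3.12; typed ≠ proved.
-/

namespace Literature.AnabelianGeometry.SemiGraphs

namespace ProfiniteSemiGraph

open CategoryTheory Topology

universe u

variable (𝒢 : ProfiniteSemiGraph.{u})

/-- **A compact subgroup of `π₁^temp(𝒢)` in NO verticial subgroup is LEVELWISE EDGE-LIKE from some level on**
(canonical chart; any countable `𝒢` as in Prop 3.6; no hypothesis on the edge groups): for every large level `m`,
all level-`m` components of `K` lie in `σ_m^{f·b_*(Π_e)·f⁻¹}` for ONE point sequence, ONE branch and ONE conjugator.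
[cite: MochizukiSemiAnbd2006, Rmk 2.2.1 p.24] -/
theorem exists_level_forall_proj_eq_gal_conj_brHom_of_forall_not_le_verticial (h36 : 𝒢.Prop36Hypotheses)
    (K : Subgroup (𝒢.temperedPiChart h36).G) (hKc : IsCompact (K : Set (𝒢.temperedPiChart h36).G))
    (hno : ∀ (v : 𝒢.graph.Vertex) (H : Subgroup (𝒢.temperedPiChart h36).G),
      H ∈ verticialSubgroups (𝒢.temperedPiChart h36) v → ¬ K ≤ H) :
    ∃ j₁ : ℕ, ∀ m, j₁ ≤ m →
      ∃ (w : 𝒢.graph.Vertex) (P : (𝒢.galoisLevelData h36).PointSeq h36.isCountable w)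
        (b : 𝒢.graph.Branch) (hb : 𝒢.graph.abuts b = some w) (f : 𝒢.Gv w),
        ∀ g ∈ K, ∃ k : 𝒢.Ge (𝒢.graph.edgeOf b),
          (𝒢.galoisLevelData h36).proj h36.isCountable m g = P.gal m (f * 𝒢.brHom b w hb k * f⁻¹) := by
  classical
  let D₀ : VerticialLevelData.{0} 𝒢 (𝒢.temperedPiChart h36) := verticialLevelData_temperedPiChart (h36 := h36)
  -- [SemiAnbd] Lemma 1.8 (ii): the compact `K` fixes a vertex of every `𝒢_{∞,j}`
  have hfixK : ∀ j : D₀.J, ∃ z : (D₀.tree j).Vertex, ∀ g ∈ K, (D₀.act j g).hom.vertexMap z = z := by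
    intro j
    obtain ⟨z, hz⟩ := SemiGraph.exists_fixed_vertex_of_isCompact_over K hKc (D₀.isTree j) (D₀.vertex j)
      (D₀.proj j) (D₀.act j) (D₀.isOpen_ker j) (D₀.act_over j)
    exact ⟨z, fun g hg => hz ⟨g, hg⟩⟩
  by_cases hA : ∀ j₁ : D₀.J, ∃ j : D₀.J, j₁ ≤ j ∧ ∀ z z' : (D₀.tree j).Vertex,
      (∀ g ∈ K, (D₀.act j g).hom.vertexMap z = z) → (∀ g ∈ K, (D₀.act j g).hom.vertexMap z' = z') → z = z'
  · /- (A) cofinally ONE fixed vertex ⇒ `K` in a verticial subgroup — excluded. -/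
    exfalso
    choose φ hφle hφuniq using hA
    choose z hz using hfixK
    have hzimg : ∀ (i : D₀.J) (m : D₀.J) (h : φ i ≤ m), (D₀.trans h).vertexMap (z m) = z (φ i) := by
      intro i m h
      refine hφuniq i _ _ (fun g hg => ?_) (hz (φ i))
      rw [← D₀.trans_act_vertexMap h g (z m), hz m g hg]
    let y : ∀ i : D₀.J, (D₀.tree i).Vertex := fun i => (D₀.trans (hφle i)).vertexMap (z (φ i))
    have hy : ∀ ⦃i i' : D₀.J⦄ (h : i ≤ i'), (D₀.trans h).vertexMap (y i') = y i := by
      intro i i' h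
      obtain ⟨M, hM, hM'⟩ := exists_ge_ge (φ i) (φ i')
      change (D₀.trans h).vertexMap ((D₀.trans (hφle i')).vertexMap (z (φ i'))) =
        (D₀.trans (hφle i)).vertexMap (z (φ i))
      rw [← hzimg i M hM, ← hzimg i' M hM', D₀.trans_vertexMap_comp, D₀.trans_vertexMap_comp,
        D₀.trans_vertexMap_comp]
    have hfy : ∀ g ∈ K, ∀ i, (D₀.act i g).hom.vertexMap (y i) = y i := by
      intro g hg i
      change (D₀.act i g).hom.vertexMap ((D₀.trans (hφle i)).vertexMap (z (φ i))) =
        (D₀.trans (hφle i)).vertexMap (z (φ i))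
      rw [← D₀.trans_act_vertexMap (hφle i) g, hz (φ i) g hg]
    obtain ⟨v, H, hH, hst⟩ := D₀.stab y hy
    exact hno v H hH fun g hg => hst g fun i => hfy g hg i
  · /- (B) eventually TWO fixed vertices: a fixed branch at a fixed vertex; one conjugator per branch. -/
    push Not at hA
    obtain ⟨j₁, hj₁⟩ := hA
    refine ⟨j₁, fun m hm => ?_⟩
    obtain ⟨z, z', hz, hz', hne⟩ := hj₁ m hm
    obtain ⟨β, hβz, hβfix⟩ := D₀.exists_fixed_branch_of_two_fixed_vertices K m hne hz hz'
    obtain ⟨P, hP⟩ := exists_pointSeq_vertex_eq_galoisLevelData h36 m z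
    have hb : 𝒢.graph.abuts (((𝒢.galoisLevelData h36).treeProj m).branchMap β) =
        some (((𝒢.galoisLevelData h36).treeProj m).vertexMap z) :=
      ((𝒢.galoisLevelData h36).treeProj m).abuts_branchMap β z hβz
    obtain ⟨f, hf⟩ := P.exists_conj_forall_gal_brHom_of_branchMap_eq m _ hb β rfl (hP.symm ▸ hβz)
    exact ⟨_, P, _, hb, f, fun g hg => hf g (hβfix g hg)⟩

/-- **With TOPOLOGICALLY CYCLIC edge groups, a compact subgroup of `π₁^temp(𝒢)` in NO verticial subgroup is
LEVELWISE CYCLIC** (canonical chart; any countable `𝒢` as in Prop 3.6, any `𝔾`): at EVERY level `j` all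
components `ρ_j(g)`, `g ∈ K`, lie in ONE cyclic subgroup `⟨γ_j⟩` of `Gal(𝒢_{∞,j}/𝒢)` — the continuous image of the
procyclic `Π_e` in the discrete `Gal` at the large levels, transported down by `mapLE`.  So every exotic compact
subgroup is an inverse limit of finite cyclic groups. [cite: MochizukiSemiAnbd2006, Thm 3.7(iv) p.41] -/
theorem forall_level_exists_zpowers_of_forall_not_le_verticial_of_topCyclic (h36 : 𝒢.Prop36Hypotheses)
    (hcyc : ∀ e : 𝒢.graph.Edge, ∃ t₀ : 𝒢.Ge e, (Subgroup.zpowers t₀).topologicalClosure = ⊤)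
    (K : Subgroup (𝒢.temperedPiChart h36).G) (hKc : IsCompact (K : Set (𝒢.temperedPiChart h36).G))
    (hno : ∀ (v : 𝒢.graph.Vertex) (H : Subgroup (𝒢.temperedPiChart h36).G),
      H ∈ verticialSubgroups (𝒢.temperedPiChart h36) v → ¬ K ≤ H) :
    ∀ j : ℕ, ∃ γ : (𝒢.galoisLevelData h36).Gal h36.isCountable j,
      ∀ g ∈ K, (𝒢.galoisLevelData h36).proj h36.isCountable j g ∈ Subgroup.zpowers γ := by
  obtain ⟨j₁, hj₁⟩ :=
    𝒢.exists_level_forall_proj_eq_gal_conj_brHom_of_forall_not_le_verticial h36 K hKc hno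
  -- the large levels
  have hlarge : ∀ m, j₁ ≤ m → ∃ γ : (𝒢.galoisLevelData h36).Gal h36.isCountable m,
      ∀ g ∈ K, (𝒢.galoisLevelData h36).proj h36.isCountable m g ∈ Subgroup.zpowers γ := by
    intro m hm
    obtain ⟨w, P, b, hb, f, hK⟩ := hj₁ m hm
    obtain ⟨t₀, ht₀⟩ := hcyc (𝒢.graph.edgeOf b)
    -- the continuous homomorphism `Φ : Π_e → Gal_m`, `k ↦ σ_m^{f·b_*(k)·f⁻¹}`
    let Φ : 𝒢.Ge (𝒢.graph.edgeOf b) →* (𝒢.galoisLevelData h36).Gal h36.isCountable m :=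
      (((𝒢.galoisLevelData h36).proj h36.isCountable m).comp P.decompHom).comp
        ((MulAut.conj f).toMonoidHom.comp (𝒢.brHom b w hb).toMonoidHom)
    have hΦ : ∀ k, Φ k = P.gal m (f * 𝒢.brHom b w hb k * f⁻¹) := fun k => rfl
    have hΦc : Continuous Φ :=
      (((𝒢.galoisLevelData h36).continuous_proj h36.isCountable m).comp P.continuous_decompHom).comp
        ((continuous_const.mul continuous_id).mul continuous_const |>.comp (𝒢.brHom b w hb).continuous)
    refine ⟨Φ t₀, fun g hg => ?_⟩
    obtain ⟨k, hk⟩ := hK g hg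
    rw [hk, ← hΦ]
    -- `Φ k ∈ Φ(closure ⟨t₀⟩) ⊆ closure (Φ ⟨t₀⟩) = ⟨Φ t₀⟩` (discrete codomain)
    have hkmem : k ∈ (Subgroup.zpowers t₀).topologicalClosure := by rw [ht₀]; trivial
    have h1 : Φ k ∈ closure ((Φ : 𝒢.Ge (𝒢.graph.edgeOf b) → _) '' (Subgroup.zpowers t₀ : Set _)) :=
      image_closure_subset_closure_image hΦc ⟨k, hkmem, rfl⟩
    rw [closure_eq_iff_isClosed.mpr (isClosed_discrete _)] at h1
    obtain ⟨k', hk', hk'eq⟩ := h1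
    rw [← hk'eq]
    obtain ⟨n, rfl⟩ := Subgroup.mem_zpowers_iff.mp hk'
    rw [map_zpow]
    exact Subgroup.zpow_mem_zpowers _ _
  -- all levels, by `mapLE`
  intro j
  obtain ⟨γ, hγ⟩ := hlarge (max j j₁) (le_max_right j j₁)
  refine ⟨(𝒢.galoisLevelData h36).mapLE h36.isCountable (le_max_left j j₁) γ, fun g hg => ?_⟩
  rw [← (𝒢.galoisLevelData h36).mapLE_proj h36.isCountable (le_max_left j j₁) g]
  obtain ⟨n, hn⟩ := Subgroup.mem_zpowers_iff.mp (hγ g hg)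
  rw [← hn, map_zpow]
  exact Subgroup.zpow_mem_zpowers _ _

/-! ### Instances: the rayless star `𝒢⋆(p)` and the ray `𝒢_θ(p, n)` -/

section Instances

variable (p : ℕ) [hp : Fact p.Prime] (n : ℕ → ℕ)

/-- `ℤ_p` (written multiplicatively) is topologically cyclic, generated by `1` (abc-iut-L3's
`FreeProPRankTwo.topologicalClosure_zpowers_ofAdd_one`). [cite: RibesZalesskii2010, §4.1] -/
theorem multiplicative_padicInt_topCyclic :
    ∃ t₀ : Multiplicative ℤ_[p], (Subgroup.zpowers t₀).topologicalClosure = ⊤ :=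
  ⟨Multiplicative.ofAdd 1, FreeProPRankTwo.topologicalClosure_zpowers_ofAdd_one p⟩

/-- **At `𝒢⋆(p)`: every compact subgroup of `π₁^temp(𝒢⋆(p))` (canonical chart) lying in no verticial subgroup —
e.g. the escaping `⟨c⟩‾` — is LEVELWISE CYCLIC**, hypothesis-free. [cite: MochizukiSemiAnbd2006, Thm 3.7(iv) p.41] -/
theorem metabelianLeafStar_forall_level_exists_zpowers_of_forall_not_le_verticial
    (K : Subgroup ((metabelianLeafStar p).temperedPiChart
      (metabelianLeafStar_thm37Hypotheses' p).toProp36Hypotheses).G)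
    (hKc : IsCompact (K : Set ((metabelianLeafStar p).temperedPiChart
      (metabelianLeafStar_thm37Hypotheses' p).toProp36Hypotheses).G))
    (hno : ∀ (v : (metabelianLeafStar p).graph.Vertex) (H : Subgroup ((metabelianLeafStar p).temperedPiChart
      (metabelianLeafStar_thm37Hypotheses' p).toProp36Hypotheses).G),
      H ∈ verticialSubgroups _ v → ¬ K ≤ H) :
    ∀ j : ℕ, ∃ γ : ((metabelianLeafStar p).galoisLevelData
        (metabelianLeafStar_thm37Hypotheses' p).toProp36Hypotheses).Gal
        (metabelianLeafStar_thm37Hypotheses' p).toProp36Hypotheses.isCountable j,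
      ∀ g ∈ K, ((metabelianLeafStar p).galoisLevelData
        (metabelianLeafStar_thm37Hypotheses' p).toProp36Hypotheses).proj
        (metabelianLeafStar_thm37Hypotheses' p).toProp36Hypotheses.isCountable j g ∈ Subgroup.zpowers γ :=
  (metabelianLeafStar p).forall_level_exists_zpowers_of_forall_not_le_verticial_of_topCyclic _
    (fun _ => multiplicative_padicInt_topCyclic p) K hKc hno

/-- **At `𝒢_θ(p, n)`: every compact subgroup of `π₁^temp(𝒢_θ)` (canonical chart) lying in no verticial subgroup —
e.g. abc-iut-w6-d063's exotic maximal compact subgroup — is LEVELWISE CYCLIC**, hypothesis-free.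
[cite: MochizukiSemiAnbd2006, Thm 3.7(iv) p.41] -/
theorem thetaRayFreeProP_forall_level_exists_zpowers_of_forall_not_le_verticial
    (K : Subgroup ((thetaRayFreeProP p n).temperedPiChart
      (thetaRayFreeProP_thm37Hypotheses' p n).toProp36Hypotheses).G)
    (hKc : IsCompact (K : Set ((thetaRayFreeProP p n).temperedPiChart
      (thetaRayFreeProP_thm37Hypotheses' p n).toProp36Hypotheses).G))
    (hno : ∀ (v : (thetaRayFreeProP p n).graph.Vertex) (H : Subgroup ((thetaRayFreeProP p n).temperedPiChart
      (thetaRayFreeProP_thm37Hypotheses' p n).toProp36Hypotheses).G),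
      H ∈ verticialSubgroups _ v → ¬ K ≤ H) :
    ∀ j : ℕ, ∃ γ : ((thetaRayFreeProP p n).galoisLevelData
        (thetaRayFreeProP_thm37Hypotheses' p n).toProp36Hypotheses).Gal
        (thetaRayFreeProP_thm37Hypotheses' p n).toProp36Hypotheses.isCountable j,
      ∀ g ∈ K, ((thetaRayFreeProP p n).galoisLevelData
        (thetaRayFreeProP_thm37Hypotheses' p n).toProp36Hypotheses).proj
        (thetaRayFreeProP_thm37Hypotheses' p n).toProp36Hypotheses.isCountable j g ∈ Subgroup.zpowers γ :=
  (thetaRayFreeProP p n).forall_level_exists_zpowers_of_forall_not_le_verticial_of_topCyclic _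
    (fun _ => multiplicative_padicInt_topCyclic p) K hKc hno

end Instances

end ProfiniteSemiGraph

end Literature.AnabelianGeometry.SemiGraphs
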